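import Summits.CriticalPhenomena.SAWScalingLimit.Theorems.SAWTotalPositivityCriticalBubbleBoundKestenCutPolygon
import HarnessLib

/-!
# Line `kesten-product-renewal-dictionary` (crux stmt-CriticalPhenomena-7117), c5 programme
"Madras–Slade §8.1 for `ℤ²`": stub A `ms_canon_le_upArch` — canonical SAP words are up-first arches

A canonical SAP word `w` of length `N` (`Negative.canonSet N`: a closed self-avoiding word of length
`N ≥ 4`, rooted at its lowest-then-leftmost vertex `0`, first letter `E`) read BACKWARDS, with the last
edge `{e₀, 0}` removed, is the ARCH of the polygon (the tree's `Negative.archSigma`): an `(N-1)`-step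
self-avoiding walk `0 → e₀` all of whose vertices lie in the closed upper half-plane `{y ≥ 0}`. Its
first step goes UP (`ω 1 = eUp = (0,1)`): the last letter of a canonical word is `S`
(`Haruspicy.IsCanon.getLast?`), so the reversed word starts with the letter `N`. The arch map is
injective (`Negative.archSigma_injective`; a walk is determined by its vertex function), whence

  `#canonSet N ≤ #{ω ∈ Zd.sawFun 2 (N-1) e₀ | ω 1 = eUp ∧ ∀ j ≤ N-1, 0 ≤ ω j 1}`.

This is the first (combinatorial) half of Madras–Slade's Proposition 8.1.2 (`q_N ≤ b_{N,1}` for `ℤ²`);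
the reflection of up-first arches into pinned bridges is the neighbouring stub B.

Source: N. Madras, G. Slade, *The Self-Avoiding Walk* (1993), §8.1 (Proposition 8.1.2).
-/

noncomputable section

open Literature.Probability.LatticeModels Literature.Probability.RandomPlanarGeometry Literature.Probability.RandomPlanarGeometry.SAW
open Summit.CriticalPhenomena.SAWScalingLimit.Theorems.CriticalBubbleBound.Negative
open Summit.CriticalPhenomena.SAWScalingLimit.Theorems.CriticalBubbleBound.Kesten
open Literature.Barriers.CriticalPhenomena (isotropicPolygonCount)
open Literature.Barriers.CriticalPhenomena.Haruspicy (vtx vtx_zero vtx_succ rev length_rev head?_rev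
  key_le_key IsCanon.getLast?)
open Literature.Barriers.CriticalPhenomena.Edwards2D (stepVec)
open scoped ENNReal NNReal BigOperators
open Classical

namespace Summit.CriticalPhenomena.SAWScalingLimit.Theorems.CriticalBubbleBound.Kesten.MS

/-- The vertices `j ≤ N - 1` of the arch of a canonical word of length `N` lie in the closed upper
half-plane (the arch is rooted at the lowest-then-leftmost vertex of its polygon). [folklore] -/
theorem ms_archSigma_apply_one_nonneg {N : ℕ} {w : List (Fin 4)} (hw : w ∈ canonSet N) {j : ℕ}
    (hj : j ≤ N - 1) : 0 ≤ (archSigma ⟨N, w, hw⟩).1.1.getVert j 1 := by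
  have h := Cut.archSigma_rooted ⟨N, w, hw⟩ j hj
  rw [key_le_key] at h
  simp only [Pi.zero_apply] at h
  omega

/-- The first step of the arch of a canonical word goes UP: the last letter of a canonical word is
`S`, so its reversal starts with the letter `N`. [folklore] -/
theorem ms_archSigma_getVert_one {N : ℕ} {w : List (Fin 4)} (hw : w ∈ canonSet N) :
    (archSigma ⟨N, w, hw⟩).1.1.getVert 1 = eUp := by
  have hc := (mem_canonSet.1 hw).2
  have h4 := (canon_facts hc).1
  show (archOf w hc).1.1.getVert 1 = eUp
  rw [getVert_archOf w hc (by omega)]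
  have h0 : 0 < (rev w).length := by rw [length_rev]; omega
  rw [vtx_succ (rev w) h0, vtx_zero, zero_add]
  have hhead : (rev w).head? = some 2 := by
    rw [head?_rev, hc.getLast?]
    rfl
  rw [List.head?_eq_getElem?, List.getElem?_eq_getElem h0, Option.some.injEq] at hhead
  rw [hhead]
  funext i
  fin_cases i <;> rfl

/-- The arch map `w ↦ (vertex function of the arch of w)` on canonical words of length `N` is
injective: the vertex function determines the walk, the walk determines the word. [folklore] -/
theorem ms_archSigma_getVert_injective (N : ℕ) :
    Function.Injective fun x : canonSet N => (archSigma ⟨N, x⟩).1.1.getVert := by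
  intro x y h
  have hxy : archSigma ⟨N, x⟩ = archSigma ⟨N, y⟩ :=
    Subtype.ext (Subtype.ext (SimpleGraph.Walk.ext_getVert (congrFun h)))
  exact eq_of_heq (Sigma.mk.inj_iff.1 (archSigma_injective hxy)).2

/-- **Stub A `ms_canon_le_upArch`** (Madras–Slade §8.1 for `ℤ²`): canonical SAP words of length `N`
read backwards are, injectively, up-first arches — `(N-1)`-step self-avoiding walks `0 → e₀` of the
function model with first step `+e₁ = eUp` and all vertices in `{y ≥ 0}`. Hence
`q_N ≤ #canonSet N ≤ #{up-first arches of length N - 1}`. [cite: MadrasSlade1993, Proposition 8.1.2] -/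
theorem ms_canon_le_upArch : ∀ N : ℕ, (canonSet N).card ≤ ((Zd.sawFun 2 (N - 1) e₀).filter (fun ω => ω 1 = eUp ∧ ∀ j ≤ N - 1, 0 ≤ ω j 1)).card := by
  intro N
  rw [← Finset.card_attach]
  refine Finset.card_le_card_of_injOn (fun x : canonSet N => (archSigma ⟨N, x⟩).1.1.getVert)
    (fun x _ => ?_) (ms_archSigma_getVert_injective N).injOn
  rw [Finset.mem_coe, Finset.mem_filter]
  exact ⟨Cut.getVert_archSigma_mem ⟨N, x⟩, ms_archSigma_getVert_one x.2,
    fun j hj => ms_archSigma_apply_one_nonneg x.2 hj⟩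

end Summit.CriticalPhenomena.SAWScalingLimit.Theorems.CriticalBubbleBound.Kesten.MS

end
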